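import Mathlib
import HarnessLib
import Summits.Ventures.LatticeQCDFlow.Exactness.SUNResidualLayerJacobian
import Summits.Ventures.LatticeQCDFlow.Exactness.SUNStoutLatticeLayer
import Summits.Ventures.LatticeQCDFlow.Exactness.SUNResidualCouplingLayer

/-!
# The continuous exact Jacobian of a residual-class `SU(N)` layer is UNIQUE: residual, stout and engine layers, every `N`

HONEST FRAMING: exact (Metropolis-corrected) sampling algorithms for lattice gauge theory;
figures of merit are autocorrelation/cost numbers at stated couplings and volumes; no
continuum-physics claim.

Venture `LatticeQCDFlow` (cell pub-lqcd), topic `Exactness`; FANOUT row 10 (`eng-equiv`; engine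
`equiv/residual.py`, `flows_jax/layers.py`, `flows_jax/residual_flow.py`: every residual-class layer
BOOKS one number per configuration, `logJ`, and the acceptance step treats it as THE log-Jacobian).
NEW WORK of the cell.  `SUNResidualLayerJacobian.hasJacobian_sunResidualLayer` (and its stout / engine
instances) produce SOME continuous positive exact Jacobian `J` (Liouville's form along the inverse
isotopy); `SUNResidualLayerJacobian.HasJacobian.jac_ae_eq` says two exact Jacobians of one measurable
automorphism agree almost everywhere.  Here the a.e. statement is upgraded to EVERYWHERE for
continuous Jacobians on a space whose reference measure charges open sets, and instantiated for the
three residual-class layers of the engine through their measurable-automorphism structure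
(`exists_measurableEquiv_sunResidualLayer`, `…_sunStoutLatticeLayer`, `…_engineResidualCouplingLayer`):
whatever continuous nonnegative density is certified exact for such a layer — Liouville's `J`, or a
closed form such as `∏_{a active} det Top[1, U, a]` — it is the same function.  So "the" Jacobian of a
residual-class layer is well defined pointwise, and two certificates for one layer can be compared
value by value (the engine's `logdet vs finite-difference` / `vs autodiff` unit tests compare exactly
such pairs).  Nothing is cited as a fact; no number; no definition.

* `HasJacobian.jac_eq_of_continuous` — `vol` σ-finite and positive on open sets, `F` a measurable
  automorphism, `j, j' ≥ 0` continuous with `HasJacobian vol F (ofReal ∘ j)` and `(ofReal ∘ j')`: `j = j'`;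
* **`sunResidualLayer_jacobian_unique`** — the masked residual layer `u ↦ e^{Q a y u} u` on
  `ι → SU(n)` (finite `ι`, certificate `κ < 1`, exponent jointly continuous) for `⊗ Haar_{SU(n)}`;
* **`sunStoutLatticeLayer_jacobian_unique`** — the masked STOUT layer on `GaugeConfig d L SU(n)`
  (frozen staples `h1`–`h6`, continuous frozen-link coefficient, `2(d−1)|R| < 1`);
* **`engineResidualCouplingLayer_jacobian_unique`** — the engine's general residual coupling layer
  (continuous staples and coefficients, `Σ_j Σ_{k<K} (1+k)|a_{jk}| < 1`).
-/

noncomputable section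

namespace Summit.Ventures.LatticeQCDFlow.Exactness

open Literature.MathematicalPhysics.QuantumFieldTheory
open Literature.MathematicalPhysics.QuantumFieldTheory.Luscher2010
open MeasureTheory
open scoped Matrix Matrix.Norms.Frobenius ENNReal

/-! ## Generic: continuous exact Jacobians of one automorphism coincide -/

/-- **Two continuous exact Jacobians of the same measurable automorphism are EQUAL** when the
reference measure is σ-finite and charges open sets (a.e. equality `HasJacobian.jac_ae_eq`, upgraded by
continuity). -/
theorem HasJacobian.jac_eq_of_continuous {Ω : Type*} [MeasurableSpace Ω] [TopologicalSpace Ω]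
    {vol : Measure Ω} [SigmaFinite vol] [vol.IsOpenPosMeasure] {F : Ω ≃ᵐ Ω} {j j' : Ω → ℝ}
    (hj : Continuous j) (hj' : Continuous j') (hj0 : ∀ x, 0 ≤ j x) (hj0' : ∀ x, 0 ≤ j' x)
    (h : HasJacobian vol F (fun x => ENNReal.ofReal (j x)))
    (h' : HasJacobian vol F (fun x => ENNReal.ofReal (j' x))) : j = j' := by
  have heq := (Continuous.ae_eq_iff_eq vol (ENNReal.continuous_ofReal.comp hj)
    (ENNReal.continuous_ofReal.comp hj')).1 (HasJacobian.jac_ae_eq h h')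
  exact funext fun x => (ENNReal.ofReal_eq_ofReal_iff (hj0 x) (hj0' x)).1 (congrFun heq x)

/-! ## The masked residual layer on `ι → SU(n)` -/

section Residual

variable {n : ℕ} {ι : Type*} [Fintype ι] {p : ι → Prop} [DecidablePred p]

/-- **Uniqueness of the continuous exact Jacobian of the masked `SU(n)` residual layer** (finite link
set `ι`, product Haar): exponents `Q a y : SU(n) → 𝔰𝔲(n)` read from the frozen links, `κ a y`-Lipschitz
with `0 ≤ κ a y < 1`, jointly continuous in (link, frozen links). -/
theorem sunResidualLayer_jacobian_unique
    (Q : {i // p i} → ({i // ¬p i} → Matrix.specialUnitaryGroup (Fin n) ℂ) →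
      Matrix (Fin n) (Fin n) ℂ → Matrix (Fin n) (Fin n) ℂ)
    (κ : {i // p i} → ({i // ¬p i} → Matrix.specialUnitaryGroup (Fin n) ℂ) → ℝ)
    (hQ : ∀ a y, ∀ U ∈ Matrix.specialUnitaryGroup (Fin n) ℂ, (Q a y U)ᴴ = -Q a y U ∧ (Q a y U).trace = 0)
    (hlip : ∀ a y, ∀ U ∈ Matrix.specialUnitaryGroup (Fin n) ℂ, ∀ V ∈ Matrix.specialUnitaryGroup (Fin n) ℂ,
      frobNorm (Q a y U - Q a y V) ≤ κ a y * frobNorm (U - V))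
    (hκ0 : ∀ a y, 0 ≤ κ a y) (hκ : ∀ a y, κ a y < 1)
    (hQc : ∀ a, Continuous fun q : Matrix.specialUnitaryGroup (Fin n) ℂ ×
      ({i // ¬p i} → Matrix.specialUnitaryGroup (Fin n) ℂ) => Q a q.2 (q.1 : Matrix (Fin n) (Fin n) ℂ))
    {Φ : (ι → Matrix.specialUnitaryGroup (Fin n) ℂ) → (ι → Matrix.specialUnitaryGroup (Fin n) ℂ)}
    (hΦ : Φ = Theory2.coupleFun p fun a y (u : Matrix.specialUnitaryGroup (Fin n) ℂ) =>
      (⟨NormedSpace.exp (Q a y u) * u, residual_value_mem (hQ a y) u.2⟩ : Matrix.specialUnitaryGroup (Fin n) ℂ))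
    {j j' : (ι → Matrix.specialUnitaryGroup (Fin n) ℂ) → ℝ} (hj : Continuous j) (hj' : Continuous j')
    (hj0 : ∀ U, 0 ≤ j U) (hj0' : ∀ U, 0 ≤ j' U)
    (h : HasJacobian (Measure.pi fun _ : ι => haarProbability (Matrix.specialUnitaryGroup (Fin n) ℂ)) Φ
      (fun U => ENNReal.ofReal (j U)))
    (h' : HasJacobian (Measure.pi fun _ : ι => haarProbability (Matrix.specialUnitaryGroup (Fin n) ℂ)) Φ
      (fun U => ENNReal.ofReal (j' U))) :
    j = j' := by
  haveI : (haarProbability (Matrix.specialUnitaryGroup (Fin n) ℂ)).IsOpenPosMeasure := by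
    unfold haarProbability; infer_instance
  obtain ⟨Ψ, hΨ⟩ := exists_measurableEquiv_sunResidualLayer (p := p) Q κ hQ hlip hκ0 hκ hQc
  rw [hΦ, ← hΨ] at h h'
  exact HasJacobian.jac_eq_of_continuous hj hj' hj0 hj0' h h'

end Residual

/-! ## The stout layer and the engine's residual coupling layer on the lattice -/

section Lattice

variable {d L n : ℕ} [NeZero L]

/-- **Uniqueness of the continuous exact Jacobian of the masked `SU(N)` STOUT layer**, every `N`,
`d`, `L`, every mask meeting `h1`–`h6`, frozen-link coefficient `ρ V e = R e (V|frozen)` continuous with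
`2(d−1)|R| < 1`: two continuous nonnegative exact Jacobians for product Haar coincide everywhere. -/
theorem sunStoutLatticeLayer_jacobian_unique (p : Edge d L → Prop) [DecidablePred p]
    (ρ : GaugeConfig d L (Matrix.specialUnitaryGroup (Fin n) ℂ) → Edge d L → ℝ)
    (R : (e : Edge d L) → ({f : Edge d L // ¬p f} → Matrix.specialUnitaryGroup (Fin n) ℂ) → ℝ)
    (hR : ∀ V e, p e → ρ V e = R e (fun f => V f)) (hRc : ∀ e, p e → Continuous (R e))
    (h1 : ∀ e, p e → ∀ ν, ν ≠ e.2 → ¬p (e.1.shift e.2, ν))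
    (h2 : ∀ e, p e → ∀ ν, ν ≠ e.2 → ¬p (e.1.shift ν, e.2))
    (h3 : ∀ e, p e → ∀ ν, ν ≠ e.2 → ¬p (e.1, ν))
    (h4 : ∀ e, p e → ∀ ν, ν ≠ e.2 → ¬p ((e.1 - Pi.single ν 1).shift e.2, ν))
    (h5 : ∀ e, p e → ∀ ν, ν ≠ e.2 → ¬p (e.1 - Pi.single ν 1, e.2))
    (h6 : ∀ e, p e → ∀ ν, ν ≠ e.2 → ¬p (e.1 - Pi.single ν 1, ν))
    (hκ : ∀ e y, p e → 2 * (d - 1 : ℝ) * |R e y| < 1)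
    {Φ : GaugeConfig d L (Matrix.specialUnitaryGroup (Fin n) ℂ) → GaugeConfig d L (Matrix.specialUnitaryGroup (Fin n) ℂ)}
    (hΦ : Φ = fun (V : GaugeConfig d L (Matrix.specialUnitaryGroup (Fin n) ℂ)) (e : Edge d L) =>
      if p e then
        (⟨NormedSpace.exp ((ρ V e : ℂ) • suProj (plaquetteLoopSum V e.1 e.2)),
            exp_smul_suProj_mem (ρ V e) (plaquetteLoopSum V e.1 e.2)⟩ :
          Matrix.specialUnitaryGroup (Fin n) ℂ) * V e
      else V e)
    {j j' : GaugeConfig d L (Matrix.specialUnitaryGroup (Fin n) ℂ) → ℝ} (hj : Continuous j) (hj' : Continuous j')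
    (hj0 : ∀ U, 0 ≤ j U) (hj0' : ∀ U, 0 ≤ j' U)
    (h : HasJacobian (Measure.pi fun _ : Edge d L => haarProbability (Matrix.specialUnitaryGroup (Fin n) ℂ)) Φ
      (fun U => ENNReal.ofReal (j U)))
    (h' : HasJacobian (Measure.pi fun _ : Edge d L => haarProbability (Matrix.specialUnitaryGroup (Fin n) ℂ)) Φ
      (fun U => ENNReal.ofReal (j' U))) :
    j = j' := by
  haveI : (haarProbability (Matrix.specialUnitaryGroup (Fin n) ℂ)).IsOpenPosMeasure := by
    unfold haarProbability; infer_instance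
  obtain ⟨Ψ, hΨ⟩ := exists_measurableEquiv_sunStoutLatticeLayer p ρ R hR hRc h1 h2 h3 h4 h5 h6 hκ
  rw [hΦ, ← hΨ] at h h'
  exact HasJacobian.jac_eq_of_continuous hj hj' hj0 hj0' h h'

/-- **Uniqueness of the continuous exact Jacobian of the engine's general residual coupling layer**
(stout-defect / plaquette-potential: several unitary staples per link read continuously from the frozen
links, polynomial weights with continuous coefficients, certificate `Σ_j Σ_{k<K} (1+k)|a_{jk}| < 1`),
every `N`, `d`, `L`. -/
theorem engineResidualCouplingLayer_jacobian_unique {σ : Type*} [Fintype σ] (p : Edge d L → Prop)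
    [DecidablePred p] (K : ℕ)
    (C : {e : Edge d L // p e} → σ → ({f : Edge d L // ¬p f} → Matrix.specialUnitaryGroup (Fin n) ℂ) →
      Matrix (Fin n) (Fin n) ℂ)
    (hCu : ∀ a j y, C a j y ∈ Matrix.unitaryGroup (Fin n) ℂ) (hCc : ∀ a j, Continuous (C a j))
    (acoef : {e : Edge d L // p e} → σ → ℕ → ({f : Edge d L // ¬p f} → Matrix.specialUnitaryGroup (Fin n) ℂ) → ℝ)
    (hac : ∀ a j k, Continuous (acoef a j k))
    (hκ : ∀ a y, ∑ j, ∑ k ∈ Finset.range K, (1 + (k : ℝ)) * |acoef a j k y| < 1)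
    {Φ : GaugeConfig d L (Matrix.specialUnitaryGroup (Fin n) ℂ) → GaugeConfig d L (Matrix.specialUnitaryGroup (Fin n) ℂ)}
    (hΦ : Φ = Theory2.coupleFun p fun a y (u : Matrix.specialUnitaryGroup (Fin n) ℂ) =>
      (⟨NormedSpace.exp (∑ j, ((∑ k ∈ Finset.range K, acoef a j k y *
            (((u : Matrix (Fin n) (Fin n) ℂ) * C a j y).trace.re / n) ^ k : ℝ) : ℂ) •
          (-suProj ((u : Matrix (Fin n) (Fin n) ℂ) * C a j y))) * u,
        residual_value_mem (fun U _ => residualExponent_skew (fun j k => acoef a j k y) K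
          (fun j => C a j y) U) u.2⟩ : Matrix.specialUnitaryGroup (Fin n) ℂ))
    {j j' : GaugeConfig d L (Matrix.specialUnitaryGroup (Fin n) ℂ) → ℝ} (hj : Continuous j) (hj' : Continuous j')
    (hj0 : ∀ U, 0 ≤ j U) (hj0' : ∀ U, 0 ≤ j' U)
    (h : HasJacobian (Measure.pi fun _ : Edge d L => haarProbability (Matrix.specialUnitaryGroup (Fin n) ℂ)) Φ
      (fun U => ENNReal.ofReal (j U)))
    (h' : HasJacobian (Measure.pi fun _ : Edge d L => haarProbability (Matrix.specialUnitaryGroup (Fin n) ℂ)) Φ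
      (fun U => ENNReal.ofReal (j' U))) :
    j = j' := by
  haveI : SecondCountableTopology (Matrix (Fin n) (Fin n) ℂ) :=
    inferInstanceAs (SecondCountableTopology (Fin n → Fin n → ℂ))
  haveI : SecondCountableTopology (Matrix.specialUnitaryGroup (Fin n) ℂ) :=
    Topology.IsEmbedding.subtypeVal.secondCountableTopology
  haveI : (haarProbability (Matrix.specialUnitaryGroup (Fin n) ℂ)).IsOpenPosMeasure := by
    unfold haarProbability; infer_instance
  obtain ⟨Ψ, hΨ⟩ := exists_measurableEquiv_engineResidualCouplingLayer (p := p) K C hCu hCc acoef hac hκ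
  rw [hΦ, ← hΨ] at h h'
  exact HasJacobian.jac_eq_of_continuous hj hj' hj0 hj0' h h'

end Lattice

end Summit.Ventures.LatticeQCDFlow.Exactness

end
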